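import Summits.BirchSwinnertonDyer.Rank1Residual.X6.RankZeroCertificateErratumOdd
import Summits.BirchSwinnertonDyer.Rank1Residual.Supersingular.X6RankZeroErratumOddDefs
import HarnessLib

/-!
# Class X6 ∧ analytic rank `0` — ty2's `HasOddErratumPrime` (PLAN v4.8 (α2)) DECIDED in the kernel for every certificate
# record: the Named bridge of the odd-erratum certificate (p576964)

Cell `bsd-print-x6` (D-0131 (2) print tier, key `x6`; HOME `run/shared/lean/pub/bsd-print-x6/`), typer seat ty3 (gen 7).
Sibling of `RankZeroCertificateErratumOdd.lean` (p576964/p577965: Bool certificates `Record.errOddAt` / `Record.restOddAt`,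
structural theorems `Record.hasOddErratumPrime_of_check` (`∃ q, Fact q.Prime, q ≠ 2 ∧ Mult ∧ ¬ Split ∧ p ∤ ord_q Δ_min`) /
`Record.not_hasOddErratumPrime_of_check`, census 103 odd / 4 `q = 2`-only / 6 Rest of the 113 records at `p ≥ 5`) and the
pattern twin of `RankZeroCertificateInertPairNamed.lean` (p564740). ty2's light module `Supersingular.X6RankZeroErratumOddDefs`
(p577618) names the predicate: `Supersingular.HasOddErratumPrime W p := ∃ q, ∃ _ : Fact q.Prime, Mult W q ∧ ¬ Split W q ∧
¬ p ∣ padicValInt q Δ_min ∧ q ≠ 2` (conjunct `q ≠ 2` LAST) — the hypothesis of the refined Err child `ErrOdd` of children5 v2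
(`PublishedAcInputsX6ErrOdd → … → HasOddErratumPrime W p → E₅-conclusion`, closer (α3) by prover p2). This file is the
one-`obtain` bridge: the record's certificate gives / refutes ty2's NAMED predicate, per record, on the display, in the `hWeq`
shape, and by name at the four `q = 2`-only cells and the T3 witness cell. PARTITION (D-0054): leaf X6 ∧ r = 0 (K3 row A6) —
types-the-object-of; closes NONE. HONEST FRAMING: nothing about BSD or any `L`-value is asserted; kernel statements about
reduction types of explicit minimal models. Two engines: HOME/ty3/erratum/X6R0-ERRATUM-v2.tsv (= PARI `a_q`) and the kernel.
beyond-print theorem: NO. References: J. H. Silverman, *AEC* (2009) VII.5 Prop. 5.1, C.15–C.16 [SilvermanAEC2009]; F. Castella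
2018 Thm. 3.2, §5 [Castella2018]; Bertolini–Darmon–Prasanna 2013 Assumption 5.12 (3) [BertoliniDarmonPrasanna2013]; Cremona's
tables [Cremona2006]; HOME/REFEREE.md R-5.1 / S-4; HOME/PLAN.md v4.8.
-/

set_option autoImplicit false

open WeierstrassCurve Literature.NumberTheory.EllipticCurves
  Literature.NumberTheory.EllipticCurves.Rank1Residual
open Summit.BirchSwinnertonDyer.Rank1Residual.Supersingular (HasErratumPrime HasOddErratumPrime)

namespace Summit.BirchSwinnertonDyer.Rank1Residual.X6.PrintCert

/-! ### §1 Record level: the certificate gives / refutes ty2's named predicate -/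

namespace Record

variable (r : Record)

/-- **`HasOddErratumPrime W p` for a certified record with the odd certificate** — ty2's predicate (p577618) is, up to the
position of the conjunct `q ≠ 2`, the structural statement of `hasOddErratumPrime_of_check`. [cite: SilvermanAEC2009, VII.5 Prop. 5.1(b)] -/
theorem hasOddErratum_of_check (hc : r.check = true) [r.curve.IsElliptic] [r.curve.IsGloballyMinimal]
    (he : r.errOddAt = true) : HasOddErratumPrime r.curve r.p := by
  obtain ⟨q, hq, hq2, hm, hns, hram⟩ := r.hasOddErratumPrime_of_check hc he
  exact ⟨q, hq, hm, hns, hram, hq2⟩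

/-- **`¬ HasOddErratumPrime W p` for a certified record with the no-odd certificate.** [cite: SilvermanAEC2009, VII.5 Prop. 5.1(a) and (b)] -/
theorem not_hasOddErratum_of_check (hc : r.check = true) [r.curve.IsElliptic] [r.curve.IsGloballyMinimal]
    (hrest : r.restOddAt = true) : ¬ HasOddErratumPrime r.curve r.p :=
  fun h => r.not_hasOddErratumPrime_of_check hc hrest h.exists_odd

/-- A certified record with the Err certificate but the no-odd certificate: `HasErratumPrime` holds, `HasOddErratumPrime` fails —
every erratum prime is `2` (ty2's `erratumPrime_eq_two_of_not_hasOddErratumPrime`). [cite: SilvermanAEC2009, VII.5 Prop. 5.1(b)] -/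
theorem hasErratumPrime_and_not_odd_of_check (hc : r.check = true) [r.curve.IsElliptic] [r.curve.IsGloballyMinimal]
    (he : r.errAt = true) (hrest : r.restOddAt = true) :
    HasErratumPrime r.curve r.p ∧ ¬ HasOddErratumPrime r.curve r.p :=
  ⟨r.hasErratumPrime_of_check hc he, r.not_hasOddErratum_of_check hc hrest⟩

end Record

/-! ### §2 The display: ty2's predicate decided for every listed pair -/

/-- **`HasOddErratumPrime` is DECIDED on the display**: for a listed record, `HasOddErratumPrime W p ↔ errOddAt`.
[cite: SilvermanAEC2009, VII.5 Prop. 5.1(a) and (b)] -/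
theorem hasOddErratum_iff_errOddAt_of_mem (r : Record) (hr : r ∈ allRecords) :
    haveI := (r.elliptic_and_minimal_of_check (check_of_mem_of_certified certified_allRecords hr)).1
    haveI := (r.elliptic_and_minimal_of_check (check_of_mem_of_certified certified_allRecords hr)).2
    HasOddErratumPrime r.curve r.p ↔ r.errOddAt = true := by
  have hc := check_of_mem_of_certified certified_allRecords hr
  haveI := (r.elliptic_and_minimal_of_check hc).1
  haveI := (r.elliptic_and_minimal_of_check hc).2
  rcases errOddAt_or_restOddAt_of_mem r hr with ⟨he, -⟩ | ⟨he, hrest⟩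
  · exact ⟨fun _ => he, fun _ => r.hasOddErratum_of_check hc he⟩
  · refine ⟨fun h => absurd h (r.not_hasOddErratum_of_check hc hrest), fun h => ?_⟩
    rw [he] at h
    exact absurd h Bool.false_ne_true

/-- **`HasOddErratumPrime` for a listed pair with the odd certificate** (103 of the 113 records at `p ≥ 5`, `errOdd_counts_five_le`).
[cite: SilvermanAEC2009, VII.5 Prop. 5.1(b)] -/
theorem hasOddErratum_of_mem (r : Record) (hr : r ∈ allRecords) (he : r.errOddAt = true) :
    haveI := (r.elliptic_and_minimal_of_check (check_of_mem_of_certified certified_allRecords hr)).1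
    haveI := (r.elliptic_and_minimal_of_check (check_of_mem_of_certified certified_allRecords hr)).2
    HasOddErratumPrime r.curve r.p :=
  (hasOddErratum_iff_errOddAt_of_mem r hr).2 he

/-- The Err ∣ ErrOdd ∣ Rest trichotomy of the `p ≥ 5` census restated with ty2's names in view: every listed record at `p ≥ 5` has
the odd certificate (⇒ `HasOddErratumPrime`), or the Err and no-odd certificates (⇒ `HasErratumPrime ∧ ¬ HasOddErratumPrime`, the
four `q = 2`-only records), or the Rest certificate (⇒ `¬ HasErratumPrime`); counts 103 / 4 / 6 (`errOdd_counts_five_le`). [folklore] -/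
theorem errOdd_trichotomy_five_le :
    (allRecords.all fun r => !decide (5 ≤ r.p) ||
      (r.errOddAt || (r.errAt && r.restOddAt) || r.restAt)) = true := by
  decide +kernel

/-! ### §3 `hWeq` adapters and the cells by name -/

section Adapters

variable {rs : List Record} {W : WeierstrassCurve ℚ} [W.IsElliptic] [W.IsGloballyMinimal] {a1 a2 a3 a4 a6 : ℤ} {p : ℕ}

/-- **`HasOddErratumPrime W p` in the `hWeq` shape** from a certified list containing a record with these a-invariants, this `p`
and the odd certificate (membership `by decide +kernel` in the part `recordsNN` holding the label). [cite: SilvermanAEC2009, VII.5 Prop. 5.1(b)] -/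
theorem hasOddErratum_of_exists (hrs : certified rs = true)
    (h : ∃ r ∈ rs, r.ainvs = [a1, a2, a3, a4, a6] ∧ r.p = p ∧ r.errOddAt = true) (hWeq : W = ⟨a1, a2, a3, a4, a6⟩) :
    HasOddErratumPrime W p := by
  obtain ⟨q, hq, hq2, hm, hns, hram⟩ := hasOddErratumPrime_of_exists hrs h hWeq
  exact ⟨q, hq, hm, hns, hram, hq2⟩

/-- **`¬ HasOddErratumPrime W p` in the `hWeq` shape** from a certified list containing a record with these a-invariants, this `p`
and the no-odd certificate. [cite: SilvermanAEC2009, VII.5 Prop. 5.1(a) and (b)] -/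
theorem not_hasOddErratum_of_exists (hrs : certified rs = true)
    (h : ∃ r ∈ rs, r.ainvs = [a1, a2, a3, a4, a6] ∧ r.p = p ∧ r.restOddAt = true) (hWeq : W = ⟨a1, a2, a3, a4, a6⟩) :
    ¬ HasOddErratumPrime W p :=
  fun h' => not_hasOddErratumPrime_of_exists hrs h hWeq h'.exists_odd

end Adapters

section Cells

variable {W : WeierstrassCurve ℚ} [W.IsElliptic] [W.IsGloballyMinimal]

/-- The route's T3 witness cell `22678e1 @ 5` (`17, 23, 29` non-split, `ord = 1, 1, 4`): `HasOddErratumPrime W 5` — the refined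
child `ErrOdd` is inhabited at the witness cell. [cite: Cremona2006, Table 1 (Cremona label 22678e1)] -/
theorem hasOddErratum_cell_22678e1_at5 (hWeq : W = ⟨1, 0, 0, 3140254662, -139987982322460⟩) : HasOddErratumPrime W 5 :=
  hasOddErratum_of_exists certified_records14 (by decide +kernel) hWeq

/-- `65774b1 @ 5` (`q = 2`-only): `¬ HasOddErratumPrime W 5` (while `HasErratumPrime W 5`, p576964 `hasErratumPrime_cell_65774b1_at5`).
[cite: Cremona2006, Table 1 (Cremona label 65774b1)] -/
theorem not_hasOddErratum_cell_65774b1_at5 (hWeq : W = ⟨1, 1, 0, -2045, -80707⟩) : ¬ HasOddErratumPrime W 5 :=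
  not_hasOddErratum_of_exists certified_records14 (by decide +kernel) hWeq

/-- `145146q1 @ 5` (`q = 2`-only; cell C4): `¬ HasOddErratumPrime W 5`. [cite: Cremona2006, Table 1 (Cremona label 145146q1)] -/
theorem not_hasOddErratum_cell_145146q1_at5 (hWeq : W = ⟨1, 0, 1, -3229945761, -70654953055340⟩) :
    ¬ HasOddErratumPrime W 5 :=
  not_hasOddErratum_of_exists certified_records14 (by decide +kernel) hWeq

/-- `220022c1 @ 5` (`q = 2`-only): `¬ HasOddErratumPrime W 5`. [cite: Cremona2006, Table 1 (Cremona label 220022c1)] -/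
theorem not_hasOddErratum_cell_220022c1_at5 (hWeq : W = ⟨1, -1, 0, -766181797, -8161933796331⟩) :
    ¬ HasOddErratumPrime W 5 :=
  not_hasOddErratum_of_exists certified_records14 (by decide +kernel) hWeq

/-- `476882e1 @ 5` (`q = 2`-only): `¬ HasOddErratumPrime W 5`. [cite: Cremona2006, Table 1 (Cremona label 476882e1)] -/
theorem not_hasOddErratum_cell_476882e1_at5 (hWeq : W = ⟨1, 0, 1, 220814, 286977796⟩) : ¬ HasOddErratumPrime W 5 :=
  not_hasOddErratum_of_exists certified_records15 (by decide +kernel) hWeq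

/-- A former-Rest cell for contrast, `138594b1 @ 5` (all bad primes split): `¬ HasOddErratumPrime W 5` (indeed `¬ HasErratumPrime`,
p554786). [cite: Cremona2006, Table 1 (Cremona label 138594b1)] -/
theorem not_hasOddErratum_cell_138594b1_at5 (hWeq : W = ⟨1, 0, 0, -1443, -21219⟩) : ¬ HasOddErratumPrime W 5 :=
  not_hasOddErratum_of_exists certified_records14 (by decide +kernel) hWeq

end Cells

end Summit.BirchSwinnertonDyer.Rank1Residual.X6.PrintCert
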